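import Literature.AlgebraicGeometry.GroupSchemes.HopfIdealClosedSubgroup
import HarnessLib

/-!
# Points bookkeeping for `specOver`: `Γ(Spec H) ≃ₐ H`, `Spec R = 𝟙_`, sections as the convolution group, points of `Spec(A⧸I) ↪ G`

Layer `Literature/AlgebraicGeometry/GroupSchemes`, namespace `Literature.AlgebraicGeometry.GroupSchemes.AffineGroupScheme` (continues ★
`AffineGroupSchemeHopfAlgebra` p844646 and ★ `HopfIdealClosedSubgroup` p844710).  Three small `def`s (`algSpecOverEquiv`, `unitIsoSpecOver`,
`sectionsMulEquiv`) + theorems; no instance, no notation, no named fact, no `sorry`.  Cell `hodgecm-mathlib` (D-0151), programme P6 «MOD»,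
HEART support bricks for the (b1)∕(b4) hands (F0P6-p09∕p10∕p11∕p12∕p13 (g0), B-p12 (g30) σ2 «sections of `C̄ = Spec(B ⧸ I_C)` are `C`»);
B-p04 (g36).  Count-neutral Mathlib-side capital: HC_CM is proved only modulo the 7 printed citations until rung 0 closes; nothing here bears on it.

[GortzWedhorn2023] (27.1.1), §(27.2) (pp. 606–607): points of affine (group) schemes are algebra maps.  The ★ dictionary `ptEquiv G R′ :
(specOver R R′ ⟶ G) ≃ (Alg G →ₐ[R] R′)` reads points of `G` on the test objects `specOver R R′ = Spec R′ → Spec R`; this file supplies the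
bookkeeping its consumers meet at once:

* §1 **`algSpecOverEquiv H : Alg (specOver R H) ≃ₐ[R] H`** (`Γ(Spec H, 𝒪) ≅ H` as `R`-ALGEBRAS; Mathlib `Scheme.ΓSpecIso` + its naturality) and
  **`ptEquiv_specOverMapOfAlgHom`**: the point `Spec ψ : Spec R′ → Spec H` of `specOver R H` has algebra map `ψ ∘ (Γ(Spec H) ≅ H)`; hence
  `eq_specOverMapOfAlgHom` — EVERY point `specOver R R′ ⟶ specOver R H` is `Spec` of an algebra map (Spec is fully faithful);
* §2 **`unitIsoSpecOver : 𝟙_ (SchemeOver R) ≅ specOver R R`** (the base `Spec R` as the test object `R′ = R`) and, for an affine group object `G`,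
  **`sectionsMulEquiv G : (𝟙_ (SchemeOver R) ⟶ G) ≃* WithConv (Alg G →ₐ[R] R)`** — SECTIONS of `G` with Mathlib's `Hom.group` ARE the
  convolution group of augmentations `Γ(G) → R` (★ `ptMulEquiv` at `R′ = R`);
* §3 for a Hopf ideal `I`: **`ptEquiv_comp_quotIncl`** — the algebra map of a point `x ≫ quotIncl` through `Spec(A ⧸ I) ↪ G` is
  `(algebra map of x on A ⧸ I) ∘ (A ↠ A ⧸ I)` — and **`ptEquiv_quotIncl_injective`**-type consequence: points of the closed subgroup over `R′`
  ↔ algebra maps `A ⧸ I → R′` ↔ algebra maps `A → R′` killing `I` (`exists_comp_quotIncl_eq_iff_le_ker` ★).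

## References
* [GortzWedhorn2023] U. Görtz, T. Wedhorn, *Algebraic Geometry II* (2023), (27.1.1), §(27.2) (pp. 606–607).
-/

set_option autoImplicit false

-- Mathlib's `Over`/`Scheme` APIs are stated across semireducible wrappers (as in the ★ `GroupSchemes/*` files).
set_option backward.isDefEq.respectTransparency false

universe u

open CategoryTheory CategoryTheory.Limits AlgebraicGeometry MonoidalCategory CartesianMonoidalCategory TensorProduct WithConv

noncomputable section

namespace Literature.AlgebraicGeometry.GroupSchemes

namespace AffineGroupScheme

open scoped MonObj

open Literature.AlgebraicGeometry.Motives Literature.NumberTheory.DiophantineGeometry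

variable {R : Type u} [CommRing R]

/-! ## §1 `Γ(Spec H, 𝒪) ≃ₐ[R] H` and the points of `specOver R H` -/

section SpecOver

variable (H : Type u) [CommRing H] [Algebra R H]

/-- `Spec H → Spec R` has affine total space (for callers: `haveI := isAffine_specOver_left H`; instance search does not unfold
`(specOver R H).left = Spec H`). [cite: GortzWedhorn2023, §(27.2) (p. 606)] -/
theorem isAffine_specOver_left : IsAffine (specOver R H).left := inferInstanceAs (IsAffine (Spec (CommRingCat.of H)))

/-- **`Γ(Spec H, 𝒪) ≅ H` as `R`-algebras** for the `R`-scheme `specOver R H = Spec H → Spec R` (Mathlib `Scheme.ΓSpecIso`; the `R`-structures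
agree by `ΓSpecIso_naturality` applied to `R → H`). [cite: GortzWedhorn2023, §(27.2) (p. 606)] -/
def algSpecOverEquiv : Alg (specOver R H) ≃ₐ[R] H :=
  AlgEquiv.ofRingEquiv (f := (Scheme.ΓSpecIso (CommRingCat.of H)).commRingCatIsoToRingEquiv) fun r => by
    change (Scheme.ΓSpecIso (CommRingCat.of H)).hom ((algebraMapΓ (specOver R H).hom).hom r) = algebraMap R H r
    have h := congrArg (fun φ => φ.hom ((Scheme.ΓSpecIso (CommRingCat.of R)).inv.hom r))
      (Scheme.ΓSpecIso_naturality (CommRingCat.ofHom (algebraMap R H)))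
    simp only [CommRingCat.hom_comp, RingHom.coe_comp, Function.comp_apply, CommRingCat.hom_ofHom] at h
    have h2 : (algebraMapΓ (specOver R H).hom).hom r =
        (Spec.map (CommRingCat.ofHom (algebraMap R H))).appTop.hom ((Scheme.ΓSpecIso (CommRingCat.of R)).inv.hom r) := rfl
    rw [h2, h, ← CommRingCat.comp_apply, Iso.inv_hom_id, CommRingCat.id_apply]

/-- The underlying ring map of `algSpecOverEquiv H` is `Scheme.ΓSpecIso H`. [cite: GortzWedhorn2023, §(27.2) (p. 606)] -/
theorem algSpecOverEquiv_apply (a : Alg (specOver R H)) : algSpecOverEquiv H a = (Scheme.ΓSpecIso (CommRingCat.of H)).hom.hom a := rfl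

variable {H} [IsAffine (specOver R H).left] {R' : Type u} [CommRing R'] [Algebra R R']

/-- **The algebra map of the point `Spec ψ`**: for `ψ : H →ₐ[R] R′`, `ptEquiv (specOver R H) R′ (Spec ψ) = ψ ∘ (Γ(Spec H) ≅ H)`.
[cite: GortzWedhorn2023, §(27.2) (p. 606)] -/
theorem ptEquiv_specOverMapOfAlgHom (ψ : H →ₐ[R] R') :
    ptEquiv (specOver R H) R' (AlgPoints.specOverMapOfAlgHom ψ) = ψ.comp (algSpecOverEquiv H).toAlgHom := by
  apply AlgHom.coe_ringHom_injective
  have h : CommRingCat.ofHom (ptEquiv (specOver R H) R' (AlgPoints.specOverMapOfAlgHom ψ)).toRingHom =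
      (Scheme.ΓSpecIso (CommRingCat.of H)).hom ≫ CommRingCat.ofHom ψ.toRingHom := by
    rw [ofHom_ptEquiv, AlgPoints.specOverMapOfAlgHom_left]
    change Spec.preimage (Spec.map (CommRingCat.ofHom ψ.toRingHom) ≫ (Spec (CommRingCat.of H)).isoSpec.hom) = _
    rw [Scheme.isoSpec_Spec_hom, ← Spec.map_comp]
    exact Spec.preimage_map _
  exact congrArg (fun φ => CommRingCat.Hom.hom φ) h

/-- **Every point `specOver R R′ ⟶ specOver R H` is `Spec` of an `R`-algebra map** (`Spec` is fully faithful), namely of its algebra map read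
through `algSpecOverEquiv`. [cite: GortzWedhorn2023, §(27.2) (p. 606)] -/
theorem eq_specOverMapOfAlgHom (u : specOver R R' ⟶ specOver R H) :
    u = AlgPoints.specOverMapOfAlgHom ((ptEquiv (specOver R H) R' u).comp (algSpecOverEquiv H).symm.toAlgHom) := by
  apply (ptEquiv (specOver R H) R').injective
  rw [ptEquiv_specOverMapOfAlgHom, AlgHom.comp_assoc]
  ext a
  simp

end SpecOver

/-! ## §2 The base as a test object: `𝟙_ ≅ specOver R R`; sections as the convolution group -/

/-- **`Spec R` (the unit `𝟙_` of `SchemeOver R`) IS the test object `specOver R R`** (`Spec (algebraMap R R) = 𝟙`).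
[cite: GortzWedhorn2023, §(27.2) (p. 606)] -/
def unitIsoSpecOver : 𝟙_ (SchemeOver R) ≅ specOver R R :=
  Over.isoMk (Iso.refl _) (by
    change 𝟙 _ ≫ Spec.map (CommRingCat.ofHom (algebraMap R R)) = 𝟙 _
    rw [Algebra.algebraMap_self, CommRingCat.ofHom_id, Spec.map_id, Category.comp_id])

/-- The underlying morphism of `unitIsoSpecOver` is the identity of `Spec R`. [cite: GortzWedhorn2023, §(27.2) (p. 606)] -/
theorem unitIsoSpecOver_hom_left : (unitIsoSpecOver (R := R)).hom.left = 𝟙 (Spec (CommRingCat.of R)) := rfl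

section Sections

variable (G : SchemeOver R) [GrpObj G] [IsAffine G.left]

/-- **Sections of an affine group scheme are the convolution group of augmentations**: `(𝟙_ ⟶ G) ≃* WithConv (Γ(G) →ₐ[R] R)` — the
sections with Mathlib's `Hom.group`, precomposed with `specOver R R ≅ 𝟙_` and read by ★ `ptMulEquiv G R`.
[cite: GortzWedhorn2023, §(27.2) (27.2.1) (pp. 606–607)] -/
def sectionsMulEquiv : (𝟙_ (SchemeOver R) ⟶ G) ≃* WithConv (Alg G →ₐ[R] R) where
  toFun s := ptMulEquiv G R (unitIsoSpecOver.inv ≫ s)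
  invFun φ := unitIsoSpecOver.hom ≫ (ptMulEquiv G R).symm φ
  left_inv s := by
    change unitIsoSpecOver.hom ≫ (ptMulEquiv G R).symm (ptMulEquiv G R (unitIsoSpecOver.inv ≫ s)) = s
    rw [MulEquiv.symm_apply_apply, Iso.hom_inv_id_assoc]
  right_inv φ := by
    change ptMulEquiv G R (unitIsoSpecOver.inv ≫ unitIsoSpecOver.hom ≫ (ptMulEquiv G R).symm φ) = φ
    rw [Iso.inv_hom_id_assoc, MulEquiv.apply_symm_apply]
  map_mul' s t := by
    rw [MonObj.comp_mul, map_mul]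

/-- `sectionsMulEquiv s = toConv (ptEquiv G R (𝟙_ ≅ specOver R R ≫ s))`. [cite: GortzWedhorn2023, §(27.2) (p. 606)] -/
theorem sectionsMulEquiv_apply (s : 𝟙_ (SchemeOver R) ⟶ G) :
    sectionsMulEquiv G s = toConv (ptEquiv G R (unitIsoSpecOver.inv ≫ s)) := rfl

/-- The algebra map of the unit section is the counit (as the unit point `1` over `R`). [cite: GortzWedhorn2023, §(27.2) (27.2.1) (pp. 606–607)] -/
theorem sectionsMulEquiv_one : sectionsMulEquiv G 1 = 1 := map_one _

end Sections

/-! ## §3 Points of the closed subgroup scheme `Spec (A ⧸ I) ↪ G` -/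

section QuotPoints

variable (G : SchemeOver R) [IsAffine G.left] (I : Ideal (Alg G)) [I.IsTwoSided] {R' : Type u} [CommRing R'] [Algebra R R']

/-- **The algebra map of a point through `Spec (A ⧸ I) ↪ G`**: for `x : specOver R R′ ⟶ specOver R (A ⧸ I)`,
`ptEquiv G R′ (x ≫ quotIncl) = x̄ ∘ (A ↠ A ⧸ I)` where `x̄ : A ⧸ I →ₐ[R] R′` is the algebra map of `x` (read through `Γ(Spec(A⧸I)) ≅ A ⧸ I`).
[cite: GortzWedhorn2023, (27.1.1) and §(27.2) (p. 607)] -/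
theorem ptEquiv_comp_quotIncl [IsAffine (specOver R (Alg G ⧸ I)).left] (x : specOver R R' ⟶ specOver R (Alg G ⧸ I)) :
    ptEquiv G R' (x ≫ quotIncl G I) =
      (((ptEquiv (specOver R (Alg G ⧸ I)) R' x).comp (algSpecOverEquiv (Alg G ⧸ I)).symm.toAlgHom)).comp (Ideal.Quotient.mkₐ R I) := by
  conv_lhs => rw [eq_specOverMapOfAlgHom x]
  rw [ptEquiv_comap, ptEquiv_quotIncl]

/-- **Points of the closed subgroup over `R′` are the algebra maps of `A` killing `I`**, read through `ptEquiv`: the map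
`x ↦ ptEquiv G R′ (x ≫ quotIncl)` is injective (`quotIncl` is a monomorphism) with image `{φ | I ≤ ker φ}` (★ `exists_comp_quotIncl_eq_iff_le_ker`).
[cite: GortzWedhorn2023, (27.1.1) and §(27.2) (p. 607)] -/
theorem ptEquiv_comp_quotIncl_injective :
    Function.Injective fun x : specOver R R' ⟶ specOver R (Alg G ⧸ I) => ptEquiv G R' (x ≫ quotIncl G I) := by
  intro x y h
  haveI := mono_quotIncl G I
  rw [← cancel_mono (quotIncl G I)]
  exact (ptEquiv G R').injective h

/-- The image: an algebra map `φ : A → R′` is the algebra map of a point through `Spec (A ⧸ I)` iff it kills `I`.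
[cite: GortzWedhorn2023, (27.1.1) and §(27.2) (p. 607)] -/
theorem mem_range_ptEquiv_comp_quotIncl_iff (φ : Alg G →ₐ[R] R') :
    (φ ∈ Set.range fun x : specOver R R' ⟶ specOver R (Alg G ⧸ I) => ptEquiv G R' (x ≫ quotIncl G I)) ↔
      I ≤ RingHom.ker φ.toRingHom := by
  constructor
  · rintro ⟨x, rfl⟩
    exact le_ker_ptEquiv_comp_quotIncl G I x
  · intro h
    obtain ⟨x, hx⟩ := exists_comp_quotIncl_eq_of_le_ker G I ((ptEquiv G R').symm φ) (by rwa [Equiv.apply_symm_apply])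
    refine ⟨x, ?_⟩
    change ptEquiv G R' (x ≫ quotIncl G I) = φ
    rw [hx, Equiv.apply_symm_apply]

end QuotPoints

end AffineGroupScheme

end Literature.AlgebraicGeometry.GroupSchemes

end
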